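import Summits.Parity.GeneralizedHardyLittlewood.Theses.LeeYangFibres
import Summits.Parity.GeneralizedHardyLittlewood.Theorems.LeeYangFibresAbsoluteUpgradeSlices
import Summits.Parity.GeneralizedHardyLittlewood.Theorems.LeeYangFibresAbsoluteUpgradeSharpness
import Summits.Parity.GeneralizedHardyLittlewood.Theorems.LeeYangFibresAbsoluteUpgradeSingularProductLogLog
import Summits.Parity.GeneralizedHardyLittlewood.Theorems.LeeYangFibresRelativeDimOne
import Literature.NumberTheory.Sieve.LinearEquationsInPrimesProofs
import Summits.Parity.GeneralizedHardyLittlewood.Theorems.LeeYangFibresAbsoluteUpgradeDipDefs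
import Summits.Parity.GeneralizedHardyLittlewood.Theorems.PairsToGHL.Negative.ShiftPairDictionary
import Summits.Parity.GeneralizedHardyLittlewood.Theorems.PrimeCellsRelative.Negative.FalseWithoutConvexity
import Summits.Parity.GeneralizedHardyLittlewood.Theorems.PrimeCellsRelative.Negative.FalseWithoutBoxContainment
import Summits.Parity.GeneralizedHardyLittlewood.Theorems.LeeYangFibresAbsoluteUpgradeRoughAnatomy
import Literature.NumberTheory.Sieve.LinearEquationsInPrimesDimOne
import HarnessLib

/-!
# Disproof of `AbsoluteUpgrade` (stmt-Parity-14116) — findings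

Crux: `AbsoluteUpgrade := RelativeDimOne → DimOne` (route `LeeYangFibres`, declared residual,
re-filed as crux 2026-08-16).  `RelativeDimOne` is the `d = 1` Hardy–Littlewood statement with
Green–Tao's Conj. 1.4 error `ε (β_∞ ∏_p β_p + N)`; `DimOne` (shared target stmt-Parity-0819) has
the absolute Conj. 1.2 error `ε N`.

**Verdict of this seat (cycle 1): NO KILL, and no unconditional kill is possible with present
knowledge.**  Findings, all kernel-checked below unless marked:

* §1 `not_absoluteUpgrade_iff` : `¬ AbsoluteUpgrade ↔ RelativeDimOne ∧ ¬ DimOne`.  Every disproof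
  of the crux is simultaneously (i) a PROOF of uniform relative Hardy–Littlewood for all `t`
  (twin primes, Sophie Germain, Goldbach-in-the-shift asymptotics — HL strength) and (ii) a
  DISPROOF of the shared target `DimOne` (uniform Dickson–Hardy–Littlewood, believed).  The crux is
  TRUE in the Hardy–Littlewood world (`absoluteUpgrade_of_dimOne`) and vacuously TRUE in every
  world where `RelativeDimOne` fails (`absoluteUpgrade_of_not_relativeDimOne`) — in particular in
  the Siegel "illusory" world of `Literature/Barriers/Parity/SiegelZeroPrimePairs.lean`
  (Matomäki–Merikoski 2023 Thm 1.3: `∑ Λ(n)Λ(n+q) ≈ 2 𝔖_q X`, a factor-2 RELATIVE deviation, which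
  breaks the hypothesis, not only the conclusion).  It is false only in an intermediate world
  (relative `o(1)` accuracy uniformly, absolute failure on high-singular-series systems) that no
  theorem or standard conjecture describes.  So: not refutable; "true iff DimOne" given HL.
* §2 `singularProduct_nonneg`, `mass_nonneg` : for non-degenerate systems the singular mass
  `β_∞ ∏_p β_p ≥ 0` (needed below; small API gap in the tree).
* §3 (c: refuted natural strengthening) `not_upgradeSchema` : the PARAMETRIC upgrade — "for every
  functional `S` in place of `vonMangoldtSum`, the relative shape implies the absolute shape" — is
  FALSE.  Witness `perturbedSum`: the true main term plus an absolute perturbation `N` switched on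
  exactly on the admissible pairs of singular mass `≥ G(N)·N`, where `G → ∞` is a threshold grown
  so slowly (least `j` with `N ≤ w(j)`, `w` the scale witness of `exists_highMass_pair`, tree) that
  such pairs exist at infinitely many scales.  It satisfies `RelShape` (`relShape_perturbedSum`) and
  violates `AbsShape` at `(t, L, ε) = (2, 3, ½)` (`not_absShape_perturbedSum`).  MEANING FOR PROVERS:
  any proof of the crux must use arithmetic of `Λ` on the high-mass systems beyond the black-box
  inequality `RelativeDimOne`; `RelativeDimOne` is not "morally DimOne".
* §4 (a: load-bearing) `not_uniformMassBound`, `not_massBound_two_three` : the hypothesis under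
  which the ε-rescaling proof works (`upgradeSchema_of_uniformMassBound`, the only formal bridge) is
  false already at `(t, L) = (2, 3)` — primorial shift pairs `(n, n + w#)`, `∏_p β_p ≥ ½ ∑_{p≤w} 1/p`
  (tree: `exists_highMass_pair`).  Positive slices in the tree: `t = 1`
  (`dimOne_one_of_relativeDimOne`), bounded mass (`dimOne_bound_of_mass_le`), and
  `absoluteUpgrade_iff_highMass` (the crux ⇔ its high-mass core, `t ≥ 2`).
* §5 (hypothesis mutation) dropping the only hypothesis leaves `DimOne` itself
  (`AbsoluteUpgradeWithoutRelativeDimOne`, not refutable); strengthening the hypothesis to the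
  sibling shape `ε (1 + ∏_p β_p) N` of `InverseSieveTuples.RelToAbs` is implied by `RelativeDimOne`
  up to `ε ↦ 2ε` (`relShapeSing_of_relShape`), so that residual is at least as strong as this crux.
  QUANTITATIVE GAP (paper, not formalised: needs the upper bound `sup_{‖Ψ‖_N ≤ L} ∏_p β_p ≪_{t,L}
  (log log N)^{t-1}`, Green–Tao Lemma 1.3 + Mertens, not in the tree): `RelativeDimOne` gives
  `DimOne` up to a loss `(e^γ log log N)^{t-1}`; a RATE `ε(N) = o((log log N)^{1-t})` in
  `RelativeDimOne` would discharge the crux.  The route's own mechanism (fixed-degree hyperbolicity)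
  gives no rate — consistent with the planner's "not addressed".

* §6 `absShapeAt_of_rate` : the quantitative form — a RATE `r(N)` in the relative statement with
  `r(N)·(m(N)+1) → 0` against a mass-growth bound `m` (on paper `m ≍ (log log N)^{t-1}`) gives the
  absolute `ε N`; the route's fixed-degree mechanism yields no rate.

* §7 (line `Sketch`, PICKED) the lead's only open stub S4 `stub_logLogRate` is crux-equivalent by the
  skeleton's own `stub_logLogRate_iff` (not refutable, §1); joint sufficiency honest; NEW: its schema form
  is false too (`not_rateSchema`: the rate exchange S1 is parametric, so `RelShape ↛ LogLogRateShape`).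
  The high-mass input of §3–§4 is discharged here by the lead's `exists_pair_singularProduct_ge_loglog`
  (p90245) — `Theorems/LeeYangFibresAbsoluteUpgradeHighMass` states it verbatim (`exists_highMass_pair`,
  p78006) but is not served by the checking farm at the time of writing.

* §8 (GEN 2, cycle 1, 2026-08-16 — line `dip-margin-rate-exchange`, lead seat c1, PICKED): after the lead's
  cycle 1 every parity-free stub of the line is landed or in flight (`stub_anatomyAlong` p102212,
  `stub_cellsToDimOne`, the `MarginPoly` pieces `ModGammaDisc`/`PencilChainZero`, `stub_quantClip`); the ONLY
  open stubs are the two `RelativeDimOne`-GUARDED conjectural inputs `stub_fibreHyperbolicityAlong :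
  RelativeDimOne → FibreHyperbolicityAlong` and `stub_cellParityLawSaving : RelativeDimOne → CellParityLawSaving`.
  Findings: (i) `not_guarded_iff`, `twinPrimeConjecture_of_not_guarded` — refuting either guarded stub proves
  `RelativeDimOne` (twin primes): irrefutable exactly like the crux (§1); (ii) `guardSchema_iff` — the guard is
  INERT for black-box proofs: `RelShape` is satisfied by the bare main term (`relShape_massFunctional`), so
  "`∀ S, RelShape S → X`" is just `X`; any proof of a guarded stub must either prove the unguarded clause or use
  arithmetic of `Λ` (e.g. `noSiegelZeros_of_relativeDimOne`); (iii) `guarded_iff_not_of_not` — were the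
  UNGUARDED clause refuted, the stub would collapse to `¬ RelativeDimOne` and the line would close the crux
  only vacuously (§1 `absoluteUpgrade_of_not_relativeDimOne`); so the honest targets are the unguarded
  `FibreHyperbolicityAlong` / `CellParityLawSaving`, which are consistent with Hardy–Littlewood with
  `(log N)^{-A}`-uniform errors (paper analysis in the §8 docstrings: the fibre is a positive mixture of the
  model rows `F_{u'}` over a `u'`-window of width `O(U²/log N)`, error tilts `(log N)^{-A} ≪ θ*(U(N)) ≈
  e^{-0.93 U}`, `U = slowDegree N ≍ √(log log N)`; the saving `δ < 1` absorbs all smooth `1/log N` secondary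
  terms; `δ > 1` would be FALSE already at `t = 1` by the `li`-curvature, not formalised) — NO KILL;
  (iv) LANDED p113523 `Theorems/AbsoluteUpgrade/Negative/FibreHyperbolicityAlongLoadBearing.lean` (copied in
  §8.2): the mass floor `ηN` cannot be weakened to `0 < mass` (slab `[1/3,2/3]`, fibre ≡ 0), convexity cannot be
  dropped even at full mass (`[-N,N] ∖ ℤ`), the frozen fugacities must be STRICTLY positive (twin system,
  `w = (1,0)`), and the conclusion shape `fibre ζ = 0 → Im ζ = 0` silently asserts an inhabited joint rough cell
  (an almost-prime `t`-tuple in every admissible `(Ψ, K)`; harmless once `slowDegree N` passes the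
  `t`-dimensional sieve limit, i.e. for `N ≥ N₀(t)`, but `slowDegree N = 4` for every `N < exp(exp 100)`) —
  constraints for the promote-stub restatement; (v) LANDED p114876
  `Theorems/AbsoluteUpgrade/Negative/CellParityLawSavingLoadBearing.lean` (copied in §8.4): the box containment
  `K ⊆ [-N, N]` of `CellParityLawSaving` is load-bearing despite the free Walsh amplitudes (`(1+θ₀)+(1-θ₀) = 2`);
  (vi) NUMERICS (§8.5; the route's never-run cheapest falsifier (iii)): local `N = 10⁷` and kit j018789
  `N = 10⁸` — exact Sturm counts: ALL 192 actual fibre polynomials of `(n, n+h)`, `h ∈ {2, 6, 30}`,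
  `u ∈ {4,…,7}`, `w ∈ {1, ½, ¼, 1/20, a₁/3, →0}`, both coordinates, are REAL-ROOTED; the fitted Walsh parity
  amplitudes are `|θ_S| ≤ 1.1·10⁻³`, two orders below `θ*(u)`; fitted masses reproduce `𝔖(h)` to 0.3%.

Attacks tried (cycle 1): triviality battery on the crux (`aesop`, `exact?`, direct term: fail —
the two error shapes differ); vacuity of the hypothesis by automation (fail); junk hunt in
`vonMangoldtSum` / `archFactor` / `singularProduct` (`limUnder`, `toReal`, `toNat`, `affLinSize` at
`N = 0`, `L = 0`, `K` degenerate, odd shifts, negative leading coefficients): every junk regime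
either has bounded mass (then relative = absolute) or breaks `RelativeDimOne` too (crux vacuous);
Siegel-zero literature (relative deviations ⇒ vacuous, not false); Maier-type irregularities
(size `o(N)`, absorbed by `+N`).  Nothing separates the two shapes on a system whose von Mangoldt
sum is computable.
-/

noncomputable section

namespace Summit.Parity.GeneralizedHardyLittlewood.Cruxes.AbsoluteUpgrade.Disproof

open Filter Literature.NumberTheory.Sieve
open Summit.Parity.GeneralizedHardyLittlewood.Theses.LeeYangFibres (DimOne RelativeDimOne
  AbsoluteUpgrade)
open Summit.Parity.GeneralizedHardyLittlewood.Theorems.AbsoluteUpgrade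
  (exists_pair_singularProduct_ge_loglog stub_singularProduct_le_loglog_pow archFactor_le_two_mul)
open Summit.Parity.GeneralizedHardyLittlewood.Theorems.LeeYangFibresRelativeDimOne
  (relativeDimOne_of_dimOne twinPrimeConjecture_of_relativeDimOne)

/-! ## §1 Logical position of the crux -/

/-- **Shape of every possible disproof.** `AbsoluteUpgrade` fails iff uniform relative
Hardy–Littlewood holds for every `t` while the absolute form fails: a refutation of the crux is a
proof of `RelativeDimOne` (HL-strength) together with a refutation of the shared target `DimOne`. -/
theorem not_absoluteUpgrade_iff : ¬ AbsoluteUpgrade ↔ (RelativeDimOne ∧ ¬ DimOne) := by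
  unfold AbsoluteUpgrade
  exact Classical.not_imp

/-- The crux holds in the Hardy–Littlewood world (it is implied by its own conclusion). -/
theorem absoluteUpgrade_of_dimOne (h : DimOne) : AbsoluteUpgrade := fun _ => h

/-- The crux holds vacuously wherever uniform relative HL fails (e.g. in the Siegel illusory world
of `SiegelZeroPrimePairs`: a factor-2 relative deviation at the exceptional shift). -/
theorem absoluteUpgrade_of_not_relativeDimOne (h : ¬ RelativeDimOne) : AbsoluteUpgrade :=
  fun hR => absurd hR h

/-- With the tree's `DimOne → RelativeDimOne`: crux ∧ hypothesis ⇔ target. -/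
theorem absoluteUpgrade_and_relativeDimOne_iff : (AbsoluteUpgrade ∧ RelativeDimOne) ↔ DimOne :=
  ⟨fun h => h.1 h.2, fun h => ⟨fun _ => h, relativeDimOne_of_dimOne h⟩⟩

/-- A disproof of the crux disproves the shared target stmt-Parity-0819. -/
theorem not_dimOne_of_not_absoluteUpgrade (h : ¬ AbsoluteUpgrade) : ¬ DimOne :=
  fun hD => h fun _ => hD

/-- A disproof of the crux proves uniform relative Hardy–Littlewood for all `t`. -/
theorem relativeDimOne_of_not_absoluteUpgrade (h : ¬ AbsoluteUpgrade) : RelativeDimOne :=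
  (not_absoluteUpgrade_iff.mp h).1

/-- **Hardness certificate.** A disproof of the crux proves the twin prime conjecture
(tree: `twinPrimeConjecture_of_relativeDimOne`, the `(n, n + 2)` specialisation of
`RelativeDimOne` against Chebyshev's bound without twin primes). -/
theorem twinPrimeConjecture_of_not_absoluteUpgrade (h : ¬ AbsoluteUpgrade) :
    TwinPrimeConjecture :=
  twinPrimeConjecture_of_relativeDimOne (relativeDimOne_of_not_absoluteUpgrade h)

/-! ## §2 The singular mass is non-negative -/

/-- `∏_p β_p ≥ 0` for a system satisfying the standing hypotheses (limit of products of
non-negative local factors; Green–Tao Lemma 1.3 in the tree gives the convergence). -/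
theorem singularProduct_nonneg {d t : ℕ} {Ψ : Fin t → AffLinForm d}
    (hΨ : IsNondegenerateSystem Ψ) : 0 ≤ singularProduct Ψ :=
  ge_of_tendsto' (tendsto_singularProductPartial_holds d t Ψ hΨ) fun _ =>
    Finset.prod_nonneg fun p _ => localFactor_nonneg Ψ p

/-- `β_∞ ≥ 0`. -/
theorem archFactor_nonneg {d t : ℕ} (Ψ : Fin t → AffLinForm d) (K : Set (Fin d → ℝ)) :
    0 ≤ archFactor Ψ K :=
  ENNReal.toReal_nonneg

/-- The singular mass `β_∞ ∏_p β_p` of a non-degenerate system is `≥ 0`. -/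
theorem mass_nonneg {d t : ℕ} {Ψ : Fin t → AffLinForm d} (hΨ : IsNondegenerateSystem Ψ)
    (K : Set (Fin d → ℝ)) : 0 ≤ archFactor Ψ K * singularProduct Ψ :=
  mul_nonneg (archFactor_nonneg Ψ K) (singularProduct_nonneg hΨ)

/-! ## §3 The parametric upgrade is false -/

/-- A black-box prime-tuple sum: the signature of `vonMangoldtSum` at `d = 1` (`t` explicit). -/
abbrev SumFunctional : Type :=
  (t : ℕ) → (Fin t → AffLinForm 1) → Set (Fin 1 → ℝ) → ℕ → ℝ

/-- `RelativeDimOne` with `vonMangoldtSum` replaced by a black box `S`. -/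
def RelShape (S : SumFunctional) : Prop :=
  ∀ (t L : ℕ), 1 ≤ t → ∀ ε : ℝ, 0 < ε → ∃ N₀ : ℕ, ∀ N : ℕ, N₀ ≤ N →
    ∀ Ψ : Fin t → AffLinForm 1, IsNondegenerateSystem Ψ → affLinSize Ψ N ≤ L →
      ∀ K : Set (Fin 1 → ℝ), Convex ℝ K → K ⊆ realBox 1 N →
        |S t Ψ K N - archFactor Ψ K * singularProduct Ψ| ≤
          ε * (archFactor Ψ K * singularProduct Ψ + N)

/-- `DimOne` with `vonMangoldtSum` replaced by a black box `S`. -/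
def AbsShape (S : SumFunctional) : Prop :=
  ∀ (t L : ℕ), 1 ≤ t → ∀ ε : ℝ, 0 < ε → ∃ N₀ : ℕ, ∀ N : ℕ, N₀ ≤ N →
    ∀ Ψ : Fin t → AffLinForm 1, IsNondegenerateSystem Ψ → affLinSize Ψ N ≤ L →
      ∀ K : Set (Fin 1 → ℝ), Convex ℝ K → K ⊆ realBox 1 N →
        |S t Ψ K N - archFactor Ψ K * singularProduct Ψ| ≤ ε * (N : ℝ)

/-- The von Mangoldt sum as a `SumFunctional`. -/
def vonMangoldtFunctional : SumFunctional := fun _ Ψ K N => vonMangoldtSum Ψ K N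

/-- `RelShape Λ = RelativeDimOne` (definitionally). -/
theorem relShape_vonMangoldt_iff : RelShape vonMangoldtFunctional ↔ RelativeDimOne := Iff.rfl

/-- `AbsShape Λ = DimOne` (definitionally). -/
theorem absShape_vonMangoldt_iff : AbsShape vonMangoldtFunctional ↔ DimOne := Iff.rfl

/-- **Natural strengthening: the parametric upgrade.** "Relative accuracy implies absolute accuracy
for every functional of the admissible data." Any proof of the crux that uses `RelativeDimOne` only
as a black-box inequality would prove this. -/
def UpgradeSchema : Prop :=
  ∀ S : SumFunctional, RelShape S → AbsShape S

/-- The schema implies the crux (instantiate at `Λ`). -/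
theorem absoluteUpgrade_of_upgradeSchema (h : UpgradeSchema) : AbsoluteUpgrade :=
  fun hR => absShape_vonMangoldt_iff.mp (h _ (relShape_vonMangoldt_iff.mpr hR))

/-- The statement of the tree theorem `exists_highMass_pair` (primorial shift pairs), as a `Prop`,
so that the construction below is parametrised by it. -/
def HighMassInhabited : Prop :=
  ∀ (M : ℝ) (N₀ : ℕ), ∃ N : ℕ, N₀ ≤ N ∧
    ∃ Ψ : Fin 2 → AffLinForm 1, IsNondegenerateSystem Ψ ∧ affLinSize Ψ N ≤ 3 ∧
      ∃ K : Set (Fin 1 → ℝ), Convex ℝ K ∧ K ⊆ realBox 1 N ∧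
        M * N ≤ archFactor Ψ K * singularProduct Ψ

/-- `HighMassInhabited` holds.  (It is VERBATIM the tree theorem `exists_highMass_pair` of
`Theorems/LeeYangFibresAbsoluteUpgradeHighMass` (p78006); that module is not served by the checking farm at the
time of writing, so we derive it instead from the lead's sharper `exists_pair_singularProduct_ge_loglog`
(`Theorems/LeeYangFibresAbsoluteUpgradeSharpness`, p90245: for all large `N` a pair with `β_∞ = N` on `[-N, N]`
and `∏_p β_p ≥ c log log N`), using `log log N → ∞`.) -/
theorem highMassInhabited_holds : HighMassInhabited := by
  intro M N₀
  obtain ⟨c, hc, N₁, hN₁⟩ := exists_pair_singularProduct_ge_loglog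
  have hll : Tendsto (fun N : ℕ => Real.log (Real.log N)) atTop atTop :=
    (Real.tendsto_log_atTop.comp Real.tendsto_log_atTop).comp tendsto_natCast_atTop_atTop
  obtain ⟨N₂, hN₂⟩ := eventually_atTop.mp (hll.eventually_ge_atTop (M / c))
  obtain ⟨Ψ, hΨ, hL, hA, hS⟩ := hN₁ (max (max N₀ N₁) N₂) (le_trans (le_max_right _ _) (le_max_left _ _))
  refine ⟨max (max N₀ N₁) N₂, le_trans (le_max_left _ _) (le_max_left _ _), Ψ, hΨ, hL,
    realBox 1 _, convex_Icc _ _, subset_rfl, ?_⟩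
  rw [hA]
  have h1 : M / c ≤ Real.log (Real.log (max (max N₀ N₁) N₂ : ℕ)) := hN₂ _ (le_max_right _ _)
  have h2 : M ≤ c * Real.log (Real.log (max (max N₀ N₁) N₂ : ℕ)) := by
    rw [div_le_iff₀ hc] at h1
    linarith
  have hN0 : (0 : ℝ) ≤ (max (max N₀ N₁) N₂ : ℕ) := Nat.cast_nonneg _
  calc M * (max (max N₀ N₁) N₂ : ℕ) ≤ (c * Real.log (Real.log (max (max N₀ N₁) N₂ : ℕ))) *
        (max (max N₀ N₁) N₂ : ℕ) := by gcongr
    _ ≤ singularProduct Ψ * (max (max N₀ N₁) N₂ : ℕ) := by gcongr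
    _ = (max (max N₀ N₁) N₂ : ℕ) * singularProduct Ψ := mul_comm _ _

section Construction

variable (hH : HighMassInhabited)

/-- Scale witness: at scale `w k ≥ k` some admissible pair (`t = 2`, `L = 3`) has mass `≥ k · w k`. -/
def w (k : ℕ) : ℕ := Classical.choose (hH k k)

theorem le_w (k : ℕ) : k ≤ w hH k := (Classical.choose_spec (hH k k)).1

theorem exists_pair_w (k : ℕ) :
    ∃ Ψ : Fin 2 → AffLinForm 1, IsNondegenerateSystem Ψ ∧ affLinSize Ψ (w hH k) ≤ 3 ∧
      ∃ K : Set (Fin 1 → ℝ), Convex ℝ K ∧ K ⊆ realBox 1 (w hH k) ∧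
        (k : ℝ) * (w hH k) ≤ archFactor Ψ K * singularProduct Ψ :=
  (Classical.choose_spec (hH k k)).2

theorem exists_le_w (N : ℕ) : ∃ j : ℕ, N ≤ w hH j := ⟨N, le_w hH N⟩

/-- The slow threshold: `G N` = the least `j` with `N ≤ w j`. -/
def G (N : ℕ) : ℕ := Nat.find (exists_le_w hH N)

theorem le_w_G (N : ℕ) : N ≤ w hH (G hH N) := Nat.find_spec (exists_le_w hH N)

theorem G_le {N j : ℕ} (h : N ≤ w hH j) : G hH N ≤ j := Nat.find_min' _ h

/-- At the witnessed scales the threshold is below the witnessed mass ratio. -/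
theorem G_w_le (k : ℕ) : G hH (w hH k) ≤ k := G_le hH le_rfl

/-- `G → ∞`. -/
theorem eventually_le_G (J : ℕ) : ∃ N₁ : ℕ, ∀ N : ℕ, N₁ ≤ N → J ≤ G hH N := by
  refine ⟨(Finset.range J).sup (w hH) + 1, fun N hN => ?_⟩
  by_contra hlt
  push Not at hlt
  have h1 : w hH (G hH N) ≤ (Finset.range J).sup (w hH) :=
    Finset.le_sup (f := w hH) (Finset.mem_range.mpr hlt)
  have h2 := le_w_G hH N
  omega

/-- **The counterexample functional**: the true main term plus an absolute perturbation of size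
`N`, switched on exactly on the pairs of singular mass `≥ G(N) · N`. -/
def perturbedSum : SumFunctional := fun _ Ψ K N =>
  archFactor Ψ K * singularProduct Ψ +
    if ((G hH N : ℕ) : ℝ) * N ≤ archFactor Ψ K * singularProduct Ψ then (N : ℝ) else 0

/-- The perturbed functional has RELATIVE accuracy `o(1)` uniformly: where the perturbation is on,
`N ≤ G(N)⁻¹ · mass` and `G → ∞`. -/
theorem relShape_perturbedSum : RelShape (perturbedSum hH) := by
  intro t L _ ε hε
  obtain ⟨N₁, hN₁⟩ := eventually_le_G hH (⌈1 / ε⌉₊ + 1)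
  refine ⟨N₁, fun N hN Ψ hΨ _ K _ _ => ?_⟩
  have hmass : 0 ≤ archFactor Ψ K * singularProduct Ψ := mass_nonneg hΨ K
  have hN0 : (0 : ℝ) ≤ N := Nat.cast_nonneg N
  simp only [perturbedSum, add_sub_cancel_left]
  split_ifs with hbig
  · rw [abs_of_nonneg hN0]
    have hG : ((⌈1 / ε⌉₊ + 1 : ℕ) : ℝ) ≤ (G hH N : ℝ) := by exact_mod_cast hN₁ N hN
    have hceil : 1 / ε ≤ (⌈1 / ε⌉₊ : ℝ) := Nat.le_ceil _
    have hG' : 1 / ε < (G hH N : ℝ) := by push_cast at hG; linarith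
    have h1 : 1 < (G hH N : ℝ) * ε := (div_lt_iff₀ hε).mp hG'
    have h1' : (1 : ℝ) ≤ ε * (G hH N : ℝ) := by linarith
    calc (N : ℝ) = 1 * N := by ring
      _ ≤ (ε * (G hH N : ℝ)) * N := by gcongr
      _ = ε * (((G hH N : ℕ) : ℝ) * N) := by ring
      _ ≤ ε * (archFactor Ψ K * singularProduct Ψ) := by gcongr
      _ ≤ ε * (archFactor Ψ K * singularProduct Ψ + N) := by gcongr; linarith
  · rw [abs_zero]
    exact mul_nonneg hε.le (add_nonneg hmass hN0)

/-- ... but not ABSOLUTE accuracy: at the witnessed scales `w k` the perturbation `N` is on. -/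
theorem not_absShape_perturbedSum : ¬ AbsShape (perturbedSum hH) := by
  intro h
  obtain ⟨N₀, hN₀⟩ := h 2 3 (by norm_num) (1 / 2) (by norm_num)
  obtain ⟨Ψ, hΨ, hL, K, hK, hKN, hbig⟩ := exists_pair_w hH (N₀ + 1)
  have hNk : N₀ + 1 ≤ w hH (N₀ + 1) := le_w hH (N₀ + 1)
  have hb := hN₀ (w hH (N₀ + 1)) (by omega) Ψ hΨ hL K hK hKN
  have hon : ((G hH (w hH (N₀ + 1)) : ℕ) : ℝ) * (w hH (N₀ + 1) : ℕ) ≤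
      archFactor Ψ K * singularProduct Ψ := by
    calc ((G hH (w hH (N₀ + 1)) : ℕ) : ℝ) * (w hH (N₀ + 1) : ℕ)
        ≤ ((N₀ + 1 : ℕ) : ℝ) * (w hH (N₀ + 1) : ℕ) := by
          gcongr
          exact G_w_le hH (N₀ + 1)
      _ ≤ archFactor Ψ K * singularProduct Ψ := hbig
  simp only [perturbedSum, add_sub_cancel_left, if_pos hon, Nat.abs_cast] at hb
  have h1 : (1 : ℝ) ≤ (w hH (N₀ + 1) : ℕ) := by exact_mod_cast (show 1 ≤ w hH (N₀ + 1) by omega)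
  linarith

/-- The perturbed functional is non-negative, like `vonMangoldtSum` (so the schema fails even among
non-negative functionals). -/
theorem perturbedSum_nonneg {t : ℕ} {Ψ : Fin t → AffLinForm 1} (hΨ : IsNondegenerateSystem Ψ)
    (K : Set (Fin 1 → ℝ)) (N : ℕ) : 0 ≤ perturbedSum hH t Ψ K N := by
  have hmass := mass_nonneg hΨ K
  simp only [perturbedSum]
  split_ifs <;> positivity

end Construction

/-- Conditional form (elaborates without the HighMass module). -/
theorem not_upgradeSchema_of_highMass (hH : HighMassInhabited) : ¬ UpgradeSchema :=
  fun h => not_absShape_perturbedSum hH (h _ (relShape_perturbedSum hH))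

/-- **(c) Refuted natural strengthening.** The parametric upgrade is false: relative accuracy
`ε (β_∞ ∏_p β_p + N)` uniformly in admissible `(Ψ, K)` does NOT imply absolute accuracy `ε N` for a
general functional — so `AbsoluteUpgrade` has no proof treating `RelativeDimOne` as a black box. -/
theorem not_upgradeSchema : ¬ UpgradeSchema :=
  not_upgradeSchema_of_highMass highMassInhabited_holds

/-! ### A sharper witness: a multiplicative singular-series bias -/

section Bias

variable (hH : HighMassInhabited)

/-- **Biased Cramér model**: the main term with the singular series multiplied by
`1 + 1/G(N)` on the systems with `∏_p β_p ≥ G(N)/2` (and untouched otherwise).  It is a constant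
density integrated over `K ∩ {Ψ > 0}` — additive and monotone in `K`, non-negative — i.e. it has
every formal property of `vonMangoldtSum` that does not involve the primes. -/
def biasedModel : SumFunctional := fun _ Ψ K N =>
  archFactor Ψ K * singularProduct Ψ *
    (1 + if ((G hH N : ℕ) : ℝ) ≤ 2 * singularProduct Ψ then 1 / ((G hH N : ℕ) : ℝ) else 0)

/-- `biasedModel - mass = mass · bias`. [folklore] -/
theorem biasedModel_sub (t : ℕ) (Ψ : Fin t → AffLinForm 1) (K : Set (Fin 1 → ℝ)) (N : ℕ) :
    biasedModel hH t Ψ K N - archFactor Ψ K * singularProduct Ψ =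
      archFactor Ψ K * singularProduct Ψ *
        (if ((G hH N : ℕ) : ℝ) ≤ 2 * singularProduct Ψ then 1 / ((G hH N : ℕ) : ℝ) else 0) := by
  simp only [biasedModel]
  ring

/-- The biased model has relative accuracy `1/G(N) → 0` uniformly. -/
theorem relShape_biasedModel : RelShape (biasedModel hH) := by
  intro t L _ ε hε
  obtain ⟨N₁, hN₁⟩ := eventually_le_G hH (⌈1 / ε⌉₊ + 1)
  refine ⟨N₁, fun N hN Ψ hΨ _ K _ _ => ?_⟩
  have hmass : 0 ≤ archFactor Ψ K * singularProduct Ψ := mass_nonneg hΨ K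
  have hN0 : (0 : ℝ) ≤ N := Nat.cast_nonneg N
  rw [biasedModel_sub]
  split_ifs with hbig
  · have hG : ((⌈1 / ε⌉₊ + 1 : ℕ) : ℝ) ≤ (G hH N : ℝ) := by exact_mod_cast hN₁ N hN
    have hceil : 1 / ε ≤ (⌈1 / ε⌉₊ : ℝ) := Nat.le_ceil _
    have hG' : 1 / ε < (G hH N : ℝ) := by push_cast at hG; linarith
    have hGpos : (0 : ℝ) < (G hH N : ℝ) := lt_trans (by positivity) hG'
    have hinv : 1 / ((G hH N : ℕ) : ℝ) ≤ ε := by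
      rw [div_le_iff₀ hGpos]
      have := (div_lt_iff₀ hε).mp hG'
      linarith
    rw [abs_of_nonneg (mul_nonneg hmass (by positivity))]
    calc archFactor Ψ K * singularProduct Ψ * (1 / ((G hH N : ℕ) : ℝ))
        ≤ archFactor Ψ K * singularProduct Ψ * ε := by gcongr
      _ = ε * (archFactor Ψ K * singularProduct Ψ) := by ring
      _ ≤ ε * (archFactor Ψ K * singularProduct Ψ + N) := by gcongr; linarith
  · rw [mul_zero, abs_zero]
    exact mul_nonneg hε.le (add_nonneg hmass hN0)

/-- ... but not absolute accuracy: at a witnessed scale `N = w k` with `1 ≤ G(N) ≤ k`, the pair of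
mass `≥ k N` has `∏_p β_p ≥ k/2 ≥ G(N)/2` (as `β_∞ ≤ 2N`), so the bias is on and the absolute
error is `mass / G(N) ≥ N`. -/
theorem not_absShape_biasedModel : ¬ AbsShape (biasedModel hH) := by
  intro h
  obtain ⟨N₀, hN₀⟩ := h 2 3 (by norm_num) (1 / 2) (by norm_num)
  set k : ℕ := max (N₀ + 1) (w hH 0 + 1) with hk
  obtain ⟨Ψ, hΨ, hL, K, hK, hKN, hbig⟩ := exists_pair_w hH k
  have hNk : k ≤ w hH k := le_w hH k
  have hk1 : N₀ + 1 ≤ k := le_max_left _ _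
  have hk2 : w hH 0 + 1 ≤ k := le_max_right _ _
  have hb := hN₀ (w hH k) (by omega) Ψ hΨ hL K hK hKN
  -- `1 ≤ G (w k) ≤ k`
  have hGk : G hH (w hH k) ≤ k := G_w_le hH k
  have hG1 : 1 ≤ G hH (w hH k) := by
    by_contra h0
    push Not at h0
    have hG0 : G hH (w hH k) = 0 := by omega
    have := le_w_G hH (w hH k)
    rw [hG0] at this
    omega
  have hN1 : (1 : ℝ) ≤ (w hH k : ℕ) := by exact_mod_cast (show 1 ≤ w hH k by omega)
  have hkR : (1 : ℝ) ≤ (k : ℝ) := by exact_mod_cast (show 1 ≤ k by omega)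
  have hGkR : ((G hH (w hH k) : ℕ) : ℝ) ≤ (k : ℝ) := by exact_mod_cast hGk
  have hG1R : (1 : ℝ) ≤ ((G hH (w hH k) : ℕ) : ℝ) := by exact_mod_cast hG1
  have hS0 : 0 ≤ singularProduct Ψ := singularProduct_nonneg hΨ
  have hA := Summit.Parity.GeneralizedHardyLittlewood.Theorems.AbsoluteUpgrade.archFactor_le_two_mul
    Ψ hKN
  -- the bias is on: `G ≤ k ≤ 2 ∏ β_p` since `k · N ≤ β_∞ ∏β_p ≤ 2N ∏β_p`
  have hon : ((G hH (w hH k) : ℕ) : ℝ) ≤ 2 * singularProduct Ψ := by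
    have h2 : (k : ℝ) * (w hH k : ℕ) ≤ 2 * (w hH k : ℕ) * singularProduct Ψ :=
      hbig.trans (mul_le_mul_of_nonneg_right hA hS0)
    have h3 : (k : ℝ) ≤ 2 * singularProduct Ψ := by
      by_contra hlt
      push Not at hlt
      have : 2 * (w hH k : ℕ) * singularProduct Ψ < (k : ℝ) * (w hH k : ℕ) := by nlinarith
      linarith
    linarith
  rw [biasedModel_sub, if_pos hon] at hb
  have hmass : 0 ≤ archFactor Ψ K * singularProduct Ψ := mass_nonneg hΨ K
  rw [abs_of_nonneg (mul_nonneg hmass (by positivity))] at hb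
  -- `mass / G ≥ mass / k ≥ N`
  have hlow : (w hH k : ℕ) ≤ archFactor Ψ K * singularProduct Ψ * (1 / ((G hH (w hH k) : ℕ) : ℝ)) := by
    have hinv : 1 / (k : ℝ) ≤ 1 / ((G hH (w hH k) : ℕ) : ℝ) :=
      one_div_le_one_div_of_le (by linarith) hGkR
    calc ((w hH k : ℕ) : ℝ) = (k : ℝ) * (w hH k : ℕ) * (1 / (k : ℝ)) := by
          field_simp
      _ ≤ archFactor Ψ K * singularProduct Ψ * (1 / (k : ℝ)) := by gcongr
      _ ≤ archFactor Ψ K * singularProduct Ψ * (1 / ((G hH (w hH k) : ℕ) : ℝ)) := by gcongr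
  linarith

/-- The biased model is non-negative. -/
theorem biasedModel_nonneg {t : ℕ} {Ψ : Fin t → AffLinForm 1} (hΨ : IsNondegenerateSystem Ψ)
    (K : Set (Fin 1 → ℝ)) (N : ℕ) : 0 ≤ biasedModel hH t Ψ K N := by
  have hmass := mass_nonneg hΨ K
  simp only [biasedModel]
  split_ifs <;> positivity

end Bias

/-- **The schema fails among biased Cramér models**: given the high-mass pairs, a multiplicative
bias `1 + 1/G(N)` of the singular series on the systems with `∏_p β_p ≥ G(N)/2`, `G → ∞` slowly,
respects `RelShape` and violates `AbsShape`.  READING: given `RelativeDimOne`, the crux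
`AbsoluteUpgrade` is exactly the exclusion of a multiplicative singular-series conspiracy
`1 + η`, `η → 0` slower than `1/∏_p β_p`, on the high-singular-series systems — a "mild" version of
the Siegel illusory correction factor (which is `η ≍ 1` and already breaks `RelativeDimOne`). -/
theorem not_upgradeSchema_of_highMass' (hH : HighMassInhabited) : ¬ UpgradeSchema :=
  fun h => not_absShape_biasedModel hH (h _ (relShape_biasedModel hH))

/-! ## §4 The only formal bridge (ε-rescaling) needs a uniform mass bound, which is false -/

/-- Uniform singular-mass bound at every `(t, L)`: `β_∞ ∏_p β_p ≤ C(t, L) N` eventually. -/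
def UniformMassBound : Prop :=
  ∀ t L : ℕ, ∃ C : ℝ, ∃ N₀ : ℕ, ∀ N : ℕ, N₀ ≤ N →
    ∀ Ψ : Fin t → AffLinForm 1, IsNondegenerateSystem Ψ → affLinSize Ψ N ≤ L →
      ∀ K : Set (Fin 1 → ℝ), Convex ℝ K → K ⊆ realBox 1 N →
        archFactor Ψ K * singularProduct Ψ ≤ C * N

/-- Under a uniform mass bound the upgrade is formal, for ANY functional: apply the relative shape
with `ε / (C + 1)`. (This is the whole content of the `t = 1` and bounded-mass slices in the tree.) -/
theorem upgradeSchema_of_uniformMassBound (h : UniformMassBound) : UpgradeSchema := by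
  intro S hS t L ht ε hε
  obtain ⟨C, N₁, hC⟩ := h t L
  have hC0 : ∀ N : ℕ, N₁ ≤ N → ∀ Ψ : Fin t → AffLinForm 1, IsNondegenerateSystem Ψ →
      affLinSize Ψ N ≤ L → ∀ K : Set (Fin 1 → ℝ), Convex ℝ K → K ⊆ realBox 1 N →
        archFactor Ψ K * singularProduct Ψ ≤ max C 0 * N := fun N hN Ψ hΨ hL K hK hKN =>
    (hC N hN Ψ hΨ hL K hK hKN).trans (by gcongr; exact le_max_left _ _)
  obtain ⟨N₂, hN₂⟩ := hS t L ht (ε / (max C 0 + 1)) (by positivity)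
  refine ⟨max N₁ N₂, fun N hN Ψ hΨ hL K hK hKN => ?_⟩
  have hm := hC0 N (le_of_max_le_left hN) Ψ hΨ hL K hK hKN
  calc |S t Ψ K N - archFactor Ψ K * singularProduct Ψ|
      ≤ ε / (max C 0 + 1) * (archFactor Ψ K * singularProduct Ψ + N) :=
        hN₂ N (le_of_max_le_right hN) Ψ hΨ hL K hK hKN
    _ ≤ ε / (max C 0 + 1) * (max C 0 * N + N) := by gcongr
    _ = ε * (N : ℝ) := by field_simp

/-- **(a) Load-bearing: the mass bound is false** (hence not available to any proof of the crux);
equivalently `sup` over admissible pairs of `β_∞ ∏_p β_p / N` is infinite at some `(t, L)`. -/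
theorem not_uniformMassBound : ¬ UniformMassBound :=
  fun h => not_upgradeSchema (upgradeSchema_of_uniformMassBound h)

/-- The mass bound fails already at `(t, L) = (2, 3)`: primorial shift pairs (tree). -/
theorem not_massBound_two_three : ¬ ∃ C : ℝ, ∃ N₀ : ℕ, ∀ N : ℕ, N₀ ≤ N →
    ∀ Ψ : Fin 2 → AffLinForm 1, IsNondegenerateSystem Ψ → affLinSize Ψ N ≤ 3 →
      ∀ K : Set (Fin 1 → ℝ), Convex ℝ K → K ⊆ realBox 1 N →
        archFactor Ψ K * singularProduct Ψ ≤ C * N := by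
  rintro ⟨C, N₀, hC⟩
  obtain ⟨N, hN, Ψ, hΨ, hL, K, hK, hKN, hbig⟩ := highMassInhabited_holds (C + 1) (max N₀ 1)
  have hle := hC N (le_of_max_le_left hN) Ψ hΨ hL K hK hKN
  have hN1 : (1 : ℝ) ≤ N := by exact_mod_cast le_of_max_le_right hN
  nlinarith

/-! ## §5 Hypothesis mutation -/

/-- Dropping the crux's only hypothesis leaves the shared target `DimOne` (stmt-Parity-0819,
Dickson–Hardy–Littlewood, believed true): NOT refutable here; recorded for the audit. -/
def AbsoluteUpgradeWithoutRelativeDimOne : Prop := DimOne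

theorem absoluteUpgradeWithoutRelativeDimOne_iff :
    AbsoluteUpgradeWithoutRelativeDimOne ↔ DimOne := Iff.rfl

/-- The sibling residual shape (route `InverseSieveTuples`, item `RelToAbs`): error
`ε (1 + ∏_p β_p) N`. -/
def RelShapeSing (S : SumFunctional) : Prop :=
  ∀ (t L : ℕ), 1 ≤ t → ∀ ε : ℝ, 0 < ε → ∃ N₀ : ℕ, ∀ N : ℕ, N₀ ≤ N →
    ∀ Ψ : Fin t → AffLinForm 1, IsNondegenerateSystem Ψ → affLinSize Ψ N ≤ L →
      ∀ K : Set (Fin 1 → ℝ), Convex ℝ K → K ⊆ realBox 1 N →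
        |S t Ψ K N - archFactor Ψ K * singularProduct Ψ| ≤
          ε * (1 + singularProduct Ψ) * (N : ℝ)

/-- `RelShape S → RelShapeSing S` (use `β_∞ ≤ 2N`, tree `archFactor_le_two_mul`): the hypothesis of
`RelToAbs` is WEAKER than `RelativeDimOne`, so `RelToAbs → AbsoluteUpgrade`-type statements; the
sibling residual is at least as strong as this crux. -/
theorem relShapeSing_of_relShape {S : SumFunctional} (h : RelShape S) : RelShapeSing S := by
  intro t L ht ε hε
  obtain ⟨N₀, hN₀⟩ := h t L ht (ε / 2) (by positivity)
  refine ⟨N₀, fun N hN Ψ hΨ hL K hK hKN => ?_⟩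
  have hA := Summit.Parity.GeneralizedHardyLittlewood.Theorems.AbsoluteUpgrade.archFactor_le_two_mul
    Ψ hKN
  have hA0 := archFactor_nonneg Ψ K
  have hS0 := singularProduct_nonneg hΨ
  have hN0 : (0 : ℝ) ≤ N := Nat.cast_nonneg N
  calc |S t Ψ K N - archFactor Ψ K * singularProduct Ψ|
      ≤ ε / 2 * (archFactor Ψ K * singularProduct Ψ + N) := hN₀ N hN Ψ hΨ hL K hK hKN
    _ ≤ ε / 2 * (2 * N * singularProduct Ψ + N) := by gcongr
    _ ≤ ε * (1 + singularProduct Ψ) * (N : ℝ) := by nlinarith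

/-- Hence the `RelToAbs`-shaped upgrade (for the von Mangoldt functional) implies this crux. -/
theorem absoluteUpgrade_of_relToAbsShape
    (h : RelShapeSing vonMangoldtFunctional → DimOne) : AbsoluteUpgrade :=
  fun hR => h (relShapeSing_of_relShape (relShape_vonMangoldt_iff.mpr hR))

/-! ## §6 What WOULD discharge the crux: a rate beating the singular-mass growth -/

/-- Relative accuracy at `(t, L)` with a RATE `r N` in place of "`∀ ε` eventually". -/
def RelShapeRate (S : SumFunctional) (t L : ℕ) (r : ℕ → ℝ) : Prop :=
  ∃ N₀ : ℕ, ∀ N : ℕ, N₀ ≤ N → ∀ Ψ : Fin t → AffLinForm 1, IsNondegenerateSystem Ψ →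
    affLinSize Ψ N ≤ L → ∀ K : Set (Fin 1 → ℝ), Convex ℝ K → K ⊆ realBox 1 N →
      |S t Ψ K N - archFactor Ψ K * singularProduct Ψ| ≤
        r N * (archFactor Ψ K * singularProduct Ψ + N)

/-- Growth bound for the singular mass at `(t, L)`: `β_∞ ∏_p β_p ≤ m(N) · N` eventually.  On paper
`m(N) ≍_{t,L} (e^γ log log N)^{t-1}` is admissible and sharp (Green–Tao Lemma 1.3 + Mertens for
`∏_{p ∣ D}(1 + 1/(p-1))`; primorial shifts for sharpness) — NOT in the tree (no Mertens in Mathlib). -/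
def MassGrowth (t L : ℕ) (m : ℕ → ℝ) : Prop :=
  ∃ N₀ : ℕ, ∀ N : ℕ, N₀ ≤ N → ∀ Ψ : Fin t → AffLinForm 1, IsNondegenerateSystem Ψ →
    affLinSize Ψ N ≤ L → ∀ K : Set (Fin 1 → ℝ), Convex ℝ K → K ⊆ realBox 1 N →
      archFactor Ψ K * singularProduct Ψ ≤ m N * N

/-- **Rate criterion.** A relative statement with rate `r(N)` gives the absolute `ε N` at `(t, L)` as
soon as `r(N) · (m(N) + 1) → 0` for a mass-growth bound `m`; with `m ≍ (log log N)^{t-1}` this asks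
for `r(N) = o((log log N)^{1-t})` — the quantitative form of the crux.  The route's mechanism
(hyperbolicity at FIXED degree `u`) yields no rate at all, which is exactly why the planner filed
the item as a residual. -/
theorem absShapeAt_of_rate {S : SumFunctional} {t L : ℕ} {r m : ℕ → ℝ}
    (hr : RelShapeRate S t L r) (hm : MassGrowth t L m) (hr0 : ∀ N, 0 ≤ r N)
    (h0 : Tendsto (fun N => r N * (m N + 1)) atTop (nhds 0)) :
    ∀ ε : ℝ, 0 < ε → ∃ N₀ : ℕ, ∀ N : ℕ, N₀ ≤ N → ∀ Ψ : Fin t → AffLinForm 1,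
      IsNondegenerateSystem Ψ → affLinSize Ψ N ≤ L → ∀ K : Set (Fin 1 → ℝ), Convex ℝ K →
        K ⊆ realBox 1 N → |S t Ψ K N - archFactor Ψ K * singularProduct Ψ| ≤ ε * N := by
  intro ε hε
  obtain ⟨N₁, hN₁⟩ := hr
  obtain ⟨N₂, hN₂⟩ := hm
  have hev : ∀ᶠ N in atTop, r N * (m N + 1) < ε :=
    (tendsto_order.1 h0).2 ε hε
  obtain ⟨N₃, hN₃⟩ := eventually_atTop.1 hev
  refine ⟨max (max N₁ N₂) N₃, fun N hN Ψ hΨ hL K hK hKN => ?_⟩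
  have h1 := hN₁ N (le_trans (le_max_left _ _) (le_of_max_le_left hN)) Ψ hΨ hL K hK hKN
  have h2 := hN₂ N (le_trans (le_max_right _ _) (le_of_max_le_left hN)) Ψ hΨ hL K hK hKN
  have h3 := hN₃ N (le_of_max_le_right hN)
  have hN0 : (0 : ℝ) ≤ N := Nat.cast_nonneg N
  calc |S t Ψ K N - archFactor Ψ K * singularProduct Ψ|
      ≤ r N * (archFactor Ψ K * singularProduct Ψ + N) := h1
    _ ≤ r N * (m N * N + N) := by gcongr; exact hr0 N
    _ = (r N * (m N + 1)) * N := by ring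
    _ ≤ ε * N := by gcongr

/-! ## §7 Line `Sketch` (lead `prover-line-stmt-Parity-14116-0`, PICKED 2026-08-16): its residual stub

The skeleton `Cruxes/AbsoluteUpgrade/Lines/Sketch.lean` has ONE open stub,
`stub_logLogRate : (MM → ¬UnboundedSiegelZeros) → RelativeDimOne → RelativeDimOneLogLogRate`, and itself
proves `stub_logLogRate_iff : S4 ↔ (guard → AbsoluteUpgrade)` — the stub is the (Siegel-guarded) crux, so
it is NOT refutable for the reason of §1 (its negation needs `RelativeDimOne ∧ ¬DimOne`; the guard is implied
by `RelativeDimOne` through S2).  Joint sufficiency is honest (`AbsoluteUpgrade_of` is proved from S1, S2, S4;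
nothing is smuggled).  What this seat adds: the stub cannot be closed with `RelativeDimOne` as a black box
EITHER — the rate exchange S1 is parametric in the functional, so the schema form of S4 is false
(`not_rateSchema`). -/

/-- The line's `RelativeDimOneLogLogRate` for a black-box functional (verbatim shape: relative part divided
by `(log log N)^{t-1}`). -/
def LogLogRateShape (S : SumFunctional) : Prop :=
  ∀ (t L : ℕ), 1 ≤ t → ∀ ε : ℝ, 0 < ε → ∃ N₀ : ℕ, ∀ N : ℕ, N₀ ≤ N → ∀ Ψ : Fin t → AffLinForm 1,
    IsNondegenerateSystem Ψ → affLinSize Ψ N ≤ L → ∀ K : Set (Fin 1 → ℝ), Convex ℝ K →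
      K ⊆ realBox 1 N →
        |S t Ψ K N - archFactor Ψ K * singularProduct Ψ| ≤
          ε * (archFactor Ψ K * singularProduct Ψ / Real.log (Real.log N) ^ (t - 1) + N)

/-- `0 < log log N` for `N ≥ 16` (as in the skeleton). -/
theorem loglog_pos {N : ℕ} (hN : 16 ≤ N) : 0 < Real.log (Real.log N) := by
  have hN' : (16 : ℝ) ≤ N := by exact_mod_cast hN
  apply Real.log_pos
  have h3 : Real.exp 1 < 3 := Real.exp_one_lt_three
  have : (1 : ℝ) < Real.log 16 := by
    rw [Real.lt_log_iff_exp_lt (by norm_num)]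
    linarith
  exact lt_of_lt_of_le this (Real.log_le_log (by norm_num) hN')

/-- **Parametric rate exchange**: the log-log rate gives the absolute shape for ANY functional (the
skeleton's `dimOne_of_logLogRate`, verbatim with `S` for `Λ`; S1 = `stub_singularProduct_le_loglog_pow`,
tree p86331, and `β_∞ ≤ 2N`). -/
theorem absShape_of_logLogRateShape {S : SumFunctional} (hrate : LogLogRateShape S) : AbsShape S := by
  intro t L ht ε hε
  obtain ⟨C, hC, N₁, hN₁⟩ := stub_singularProduct_le_loglog_pow t L ht
  obtain ⟨N₂, hN₂⟩ := hrate t L ht (ε / (2 * C + 1)) (by positivity)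
  refine ⟨max (max N₁ N₂) 16, fun N hN Ψ hΨ hL K hK hKN => ?_⟩
  have hN1 : N₁ ≤ N := le_trans (le_max_left _ _) (le_trans (le_max_left _ _) hN)
  have hN2 : N₂ ≤ N := le_trans (le_max_right _ _) (le_trans (le_max_left _ _) hN)
  have hN16 : 16 ≤ N := le_trans (le_max_right _ _) hN
  have hll : 0 < Real.log (Real.log N) := loglog_pos hN16
  have hpow : 0 < Real.log (Real.log N) ^ (t - 1) := pow_pos hll _
  have hSle := hN₁ N hN1 Ψ hΨ hL
  have harch0 : 0 ≤ archFactor Ψ K := ENNReal.toReal_nonneg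
  have harch := archFactor_le_two_mul Ψ hKN
  have hNr : (0 : ℝ) ≤ N := Nat.cast_nonneg N
  have hmass : archFactor Ψ K * singularProduct Ψ / Real.log (Real.log N) ^ (t - 1) ≤ 2 * N * C := by
    rw [div_le_iff₀ hpow]
    calc archFactor Ψ K * singularProduct Ψ
        ≤ archFactor Ψ K * (C * Real.log (Real.log N) ^ (t - 1)) :=
          mul_le_mul_of_nonneg_left hSle harch0
      _ ≤ (2 * N) * (C * Real.log (Real.log N) ^ (t - 1)) :=
          mul_le_mul_of_nonneg_right harch (by positivity)
      _ = 2 * N * C * Real.log (Real.log N) ^ (t - 1) := by ring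
  calc |S t Ψ K N - archFactor Ψ K * singularProduct Ψ|
      ≤ ε / (2 * C + 1) * (archFactor Ψ K * singularProduct Ψ / Real.log (Real.log N) ^ (t - 1) + N) :=
        hN₂ N hN2 Ψ hΨ hL K hK hKN
    _ ≤ ε / (2 * C + 1) * (2 * N * C + N) := by gcongr
    _ = ε * (N : ℝ) := by field_simp

/-- **The line's residual in schema form is false**: "relative accuracy ⟹ log-log rate" fails for the
biased Cramér model, so S4 = `stub_logLogRate` has no proof using `RelativeDimOne` only as a black-box
inequality (exactly as the crux itself, §3). -/
theorem not_rateSchema : ¬ ∀ S : SumFunctional, RelShape S → LogLogRateShape S :=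
  fun h => not_upgradeSchema fun S hS => absShape_of_logLogRateShape (h S hS)


/-! ## §8 Line `dip-margin-rate-exchange` (lead seat c1, PICKED 2026-08-16T10:32Z) — GEN 2, cycle 1

Skeleton `Cruxes/AbsoluteUpgrade/Lines/dip_margin_rate_exchange.lean` (v2), vocabulary
`Theorems/LeeYangFibresAbsoluteUpgradeDipDefs.lean`:
`AbsoluteUpgrade_of hR := stub_cellsToDimOne (stub_quantClip (stub_cellParityLawSaving hR)
(stub_fibreHyperbolicityAlong hR) stub_marginPoly stub_anatomyAlong)`.  Joint sufficiency is honest (the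
composition is kernel-checked in the skeleton and concludes the crux BY NAME).  Parity-free stubs: TRUE
(`AnatomyAlong` landed p102212 — its rate `e^{-U²}/8 ≥ (log N)^{-1/4}/8` dominates the genuine relative error
`O(U²/log N)` of Alladi's asymptotics; `MarginPoly` follows from `ModGammaDisc` + `PencilChainZero` by the
max-modulus Rouché exactly as the lead plans: on the circle `|z - ζ| = 1/(4Λ)` about the model pencil's
explicit non-real zero `ζ` (`Im ζ ≈ 1`, `Re ζ ≈ -m/2`) both main terms have size `≍ (u-1)^{Re ζ}`, the
disc error is `1/u`-relative, and the coefficient noise `u^{-m-4} F_u(|z|) ≲ u^{-m-4+|ζ|}` is below them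
because `|ζ| ≤ m/2 + 2` — the `+4` in the robustness exponent is precisely this room; the edge tilts
`θ ≈ ±1` give even/odd rows with no real zeros at all).  What is OPEN is conjectural and guarded. -/

/-! ### §8.1 Logical position of the two guarded stubs -/

section Guarded

variable (X : Prop)

/-- Refuting a `RelativeDimOne`-guarded stub means proving `RelativeDimOne` and refuting the clause. -/
theorem not_guarded_iff : ¬ (RelativeDimOne → X) ↔ (RelativeDimOne ∧ ¬ X) := Classical.not_imp

/-- Hence a refutation of `stub_fibreHyperbolicityAlong` or of `stub_cellParityLawSaving` proves the twin
prime conjecture (tree: `twinPrimeConjecture_of_relativeDimOne`). -/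
theorem twinPrimeConjecture_of_not_guarded (h : ¬ (RelativeDimOne → X)) : TwinPrimeConjecture :=
  twinPrimeConjecture_of_relativeDimOne ((not_guarded_iff X).mp h).1

/-- If the UNGUARDED clause were refuted, the guarded stub would be exactly `¬ RelativeDimOne` ... -/
theorem guarded_iff_not_of_not (hX : ¬ X) : (RelativeDimOne → X) ↔ ¬ RelativeDimOne :=
  ⟨fun h hR => hX (h hR), fun h hR => absurd hR h⟩

/-- ... and the line would then close the crux only through the vacuous branch of §1. -/
theorem absoluteUpgrade_of_guarded_of_not (hX : ¬ X) (h : RelativeDimOne → X) : AbsoluteUpgrade :=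
  absoluteUpgrade_of_not_relativeDimOne ((guarded_iff_not_of_not X hX).mp h)

/-- **The guard is inert for black-box proofs.** The relative shape is satisfied by the bare main term
(error `0`), so the hypothesis "`RelShape S` for SOME functional `S`" carries no information: -/
theorem relShape_massFunctional : RelShape (fun _ Ψ K _ => archFactor Ψ K * singularProduct Ψ) := by
  intro t L _ ε hε
  refine ⟨0, fun N _ Ψ hΨ _ K _ _ => ?_⟩
  rw [sub_self, abs_zero]
  exact mul_nonneg hε.le (add_nonneg (mass_nonneg hΨ K) (Nat.cast_nonneg N))

/-- ... a proof of a guarded stub `RelativeDimOne → X` that uses `RelativeDimOne` only as the black-box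
inequality `RelShape Λ` is a proof of `∀ S, RelShape S → X`, i.e. of the unguarded `X` itself.  (What the
guard genuinely supplies is arithmetic: e.g. `noSiegelZeros_of_relativeDimOne`, tree p89962.) -/
theorem guardSchema_iff : (∀ S : SumFunctional, RelShape S → X) ↔ X :=
  ⟨fun h => h _ relShape_massFunctional, fun hX _ _ => hX⟩

end Guarded

/-! ### §8.2 Load-bearing hypotheses of the unguarded input `FibreHyperbolicityAlong`

(LANDED as `Theorems/AbsoluteUpgrade/Negative/FibreHyperbolicityAlongLoadBearing.lean`, p113523, namespace
`…Theorems.AbsoluteUpgrade.Negative`; reproduced here so that this work file elaborates before that module is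
served.)  Each variant is FALSE unconditionally; the witnesses are junk bodies / a boundary fugacity, so these
are restatement constraints for promote time, not evidence against the clause:
mass floor `ηN` ↛ `0 < mass` (slab `[1/3, 2/3]`: no lattice point, fibre ≡ 0); convexity not droppable even at
full mass (`[-N, N] ∖ ℤ`); `0 < w_k` not weakenable to `0 ≤ w_k` (twin system, `w = (1, 0)`); and the conclusion
shape forces an inhabited joint rough cell. -/

namespace FibreAlong

open scoped Classical
open Summit.Parity.GeneralizedHardyLittlewood.Cruxes.FibreHyperbolicity.ModelTransfer (jointCell fibre)
open Summit.Parity.GeneralizedHardyLittlewood.Cruxes.AbsoluteUpgrade.DipMarginRateExchange (slowDegree)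
open Summit.Parity.GeneralizedHardyLittlewood.Theorems.PairsToGHL.Negative
  (archFactor_shiftPairSystem singularProduct_shiftPairSystem isNondegenerateSystem_shiftPairSystem_iff
    affLinSize_shiftPairSystem_le)
open Summit.Parity.GeneralizedHardyLittlewood.Theorems.PrimeCellsRelative.Negative.Convexity
  (singularProduct_id)
open MeasureTheory

/-- All joint cells vanish when no lattice point of the box has its real point in `K`. -/
theorem jointCell_eq_zero_of_forall_not_mem {t N u : ℕ} (Ψ : Fin t → AffLinForm 1)
    {K : Set (Fin 1 → ℝ)} (hK : ∀ n ∈ latticeBox 1 N, realPoint n ∉ K) (j : Fin t → ℕ) :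
    jointCell t N u Ψ K j = 0 := by
  unfold jointCell
  rw [Finset.card_eq_zero, Finset.filter_eq_empty_iff]
  intro n hn h
  exact hK n hn h.1

/-- ... hence every fibre polynomial is identically zero. -/
theorem fibre_eq_zero_of_forall_not_mem {t N u : ℕ} (Ψ : Fin t → AffLinForm 1)
    {K : Set (Fin 1 → ℝ)} (hK : ∀ n ∈ latticeBox 1 N, realPoint n ∉ K) (i : Fin t)
    (w : Fin t → ℝ) (ζ : ℂ) : fibre t N u Ψ K i w ζ = 0 := by
  unfold fibre
  refine Finset.sum_eq_zero fun j _ => ?_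
  rw [jointCell_eq_zero_of_forall_not_mem Ψ hK j]
  simp

/-- **The positive content of the conclusion shape**: real-rootedness in the form `fibre ζ = 0 → Im ζ = 0`
forces the fibre polynomial to be non-zero, i.e. some joint rough cell with index in `[1, u]^t` is inhabited
(an almost-prime `t`-tuple of roughness `N^{1/u}` in `K`). -/
theorem exists_jointCell_ne_zero_of_fibreShape {t N u : ℕ} {Ψ : Fin t → AffLinForm 1}
    {K : Set (Fin 1 → ℝ)} {i : Fin t} {w : Fin t → ℝ}
    (h : ∀ ζ : ℂ, fibre t N u Ψ K i w ζ = 0 → ζ.im = 0) :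
    ∃ j ∈ Fintype.piFinset (fun _ : Fin t => Finset.Icc 1 u), jointCell t N u Ψ K j ≠ 0 := by
  by_contra hall
  push Not at hall
  have h0 : fibre t N u Ψ K i w Complex.I = 0 := by
    unfold fibre
    refine Finset.sum_eq_zero fun j hj => ?_
    rw [hall j hj]
    simp
  have := h Complex.I h0
  simp at this

/-- No lattice point has its real point in the slab `[1/3, 2/3]`. -/
theorem realPoint_not_mem_middleThird (n : Fin 1 → ℤ) :
    realPoint n ∉ Set.Icc (fun _ : Fin 1 => (1 / 3 : ℝ)) (fun _ => 2 / 3) := by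
  rintro ⟨h1, h2⟩
  have h1' : (1 / 3 : ℝ) ≤ (n 0 : ℝ) := h1 0
  have h2' : (n 0 : ℝ) ≤ 2 / 3 := h2 0
  have h3 : (0 : ℤ) < n 0 := by
    have : (0 : ℝ) < (n 0 : ℝ) := by linarith
    exact_mod_cast this
  have h4 : (1 : ℝ) ≤ (n 0 : ℝ) := by exact_mod_cast h3
  linarith

/-- The slab lies in the box `[-N, N]` once `N ≥ 1`. -/
theorem middleThird_subset_realBox {N : ℕ} (hN : 1 ≤ N) :
    Set.Icc (fun _ : Fin 1 => (1 / 3 : ℝ)) (fun _ => 2 / 3) ⊆ realBox 1 N := by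
  rintro x ⟨h1, h2⟩
  have hN' : (1 : ℝ) ≤ N := by exact_mod_cast hN
  refine ⟨fun i => ?_, fun i => ?_⟩
  · have hi : (1 / 3 : ℝ) ≤ x i := h1 i
    show -(N : ℝ) ≤ x i
    linarith
  · have hi : x i ≤ 2 / 3 := h2 i
    show x i ≤ (N : ℝ)
    linarith

/-- `β_∞(ψ = n, [1/3, 2/3]) = 1/3`. -/
theorem archFactor_id_middleThird :
    archFactor (fun _ : Fin 1 => (⟨fun _ => 1, 0⟩ : AffLinForm 1))
      (Set.Icc (fun _ : Fin 1 => (1 / 3 : ℝ)) (fun _ => 2 / 3)) = 1 / 3 := by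
  rw [DimOne.archFactor_eq]
  have hset : {r : ℝ | (fun _ : Fin 1 => r) ∈ Set.Icc (fun _ : Fin 1 => (1 / 3 : ℝ)) (fun _ => 2 / 3) ∧
      ∀ _i : Fin 1, 0 < (⟨fun _ => 1, 0⟩ : AffLinForm 1).realEval (fun _ => r)} =
        Set.Icc (1 / 3 : ℝ) (2 / 3) := by
    ext r
    simp only [Set.mem_setOf_eq, Set.mem_Icc, Pi.le_def, DimOne.realEval_eq, Int.cast_one, one_mul,
      Int.cast_zero, add_zero, forall_const]
    constructor
    · rintro ⟨⟨h1, h2⟩, -⟩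
      exact ⟨h1, h2⟩
    · rintro ⟨h1, h2⟩
      exact ⟨⟨h1, h2⟩, by linarith⟩
  rw [hset, Real.volume_Icc, ENNReal.toReal_ofReal (by norm_num)]
  norm_num

/-- `β_∞(ψ = n, [-N, N] ∖ ℤ) = N`: the deleted set is countable, hence Lebesgue-null. -/
theorem archFactor_id_boxMinusLattice (N : ℕ) :
    archFactor (fun _ : Fin 1 => (⟨fun _ => 1, 0⟩ : AffLinForm 1))
      (realBox 1 (N : ℝ) \ {x : Fin 1 → ℝ | ∃ m : ℤ, x = fun _ => (m : ℝ)}) = N := by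
  rw [DimOne.archFactor_eq]
  have hset : {r : ℝ | (fun _ : Fin 1 => r) ∈
      realBox 1 (N : ℝ) \ {x : Fin 1 → ℝ | ∃ m : ℤ, x = fun _ => (m : ℝ)} ∧
      ∀ _i : Fin 1, 0 < (⟨fun _ => 1, 0⟩ : AffLinForm 1).realEval (fun _ => r)} =
        Set.Ioc 0 (N : ℝ) \ {r : ℝ | ∃ m : ℤ, r = m} := by
    ext r
    simp only [Set.mem_setOf_eq, Set.mem_sdiff, realBox, Set.mem_Icc, Pi.le_def,
      DimOne.realEval_eq, Int.cast_one, one_mul, Int.cast_zero, add_zero, forall_const,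
      Set.mem_Ioc]
    have hiff : (∃ m : ℤ, (fun _ : Fin 1 => r) = fun _ => (m : ℝ)) ↔ ∃ m : ℤ, r = m := by
      constructor
      · rintro ⟨m, h⟩
        exact ⟨m, congr_fun h 0⟩
      · rintro ⟨m, h⟩
        exact ⟨m, funext fun _ => h⟩
    rw [hiff]
    constructor
    · rintro ⟨⟨⟨-, h2⟩, h3⟩, h4⟩
      exact ⟨⟨h4, h2⟩, h3⟩
    · rintro ⟨⟨h1, h2⟩, h3⟩
      exact ⟨⟨⟨by linarith [Nat.cast_nonneg (α := ℝ) N], h2⟩, h3⟩, h1⟩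
  have hnull : volume {r : ℝ | ∃ m : ℤ, r = m} = 0 := by
    refine Set.Countable.measure_zero ?_ volume
    refine (Set.countable_range (Int.cast : ℤ → ℝ)).mono ?_
    rintro r ⟨m, rfl⟩
    exact ⟨m, rfl⟩
  rw [hset, measure_sdiff_null hnull, Real.volume_Ioc, ENNReal.toReal_ofReal (by simp)]
  simp

/-- Every lattice point's real point is deleted from `[-N, N] ∖ ℤ`. -/
theorem realPoint_not_mem_boxMinusLattice (N : ℕ) (n : Fin 1 → ℤ) :
    realPoint n ∉ realBox 1 (N : ℝ) \ {x : Fin 1 → ℝ | ∃ m : ℤ, x = fun _ => (m : ℝ)} := by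
  rintro ⟨-, h⟩
  exact h ⟨n 0, funext fun j => by rw [Fin.fin_one_eq_zero j]; rfl⟩

/-- The one-form system `ψ(n) = n` is non-degenerate. -/
theorem isNondegenerateSystem_id :
    IsNondegenerateSystem (fun _ : Fin 1 => (⟨fun _ => 1, 0⟩ : AffLinForm 1)) := by
  refine ⟨fun i h0 => ?_, fun i j hij => absurd (Subsingleton.elim i j) hij⟩
  have := congr_fun h0 0
  simp at this

/-- `‖(n)‖_N = 1`. -/
theorem affLinSize_id (N : ℕ) :
    affLinSize (fun _ : Fin 1 => (⟨fun _ => 1, 0⟩ : AffLinForm 1)) (N : ℝ) ≤ ((1 : ℕ) : ℝ) := by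
  simp [affLinSize]

/-- For the twin system `(n, n+2)` the fibre in coordinate `0` at the frozen fugacity `w₁ = 0` is identically
zero: every monomial carries `w₁^{j₁}` with `j₁ ≥ 1`. -/
theorem fibre_twin_eq_zero_of_fugacity_zero (N u : ℕ) (K : Set (Fin 1 → ℝ)) (ζ : ℂ) :
    fibre 2 N u (shiftPairSystem 2) K 0 (fun k => if k = 0 then 1 else 0) ζ = 0 := by
  unfold fibre
  refine Finset.sum_eq_zero fun j hj => ?_
  have hj1 : 1 ≤ j 1 := (Finset.mem_Icc.mp (Fintype.mem_piFinset.mp hj 1)).1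
  have hj1' : j 1 ≠ 0 := by omega
  rw [Fin.prod_univ_two]
  simp [zero_pow hj1']

/-- **(a) The mass floor cannot be weakened to positivity of the mass** (`t = 1`, `L = 1`, `ψ(n) = n` on the
slab `[1/3, 2/3]`: mass `1/3`, no lattice point, zero fibre, `ζ = i`). -/
theorem fibreHyperbolicityAlong_false_without_massFloor :
    ¬ (∀ (t L : ℕ), 1 ≤ t → ∃ N₀ : ℕ, ∀ N : ℕ, N₀ ≤ N →
        ∀ Ψ : Fin t → AffLinForm 1, IsNondegenerateSystem Ψ → affLinSize Ψ N ≤ L →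
        ∀ K : Set (Fin 1 → ℝ), Convex ℝ K → K ⊆ realBox 1 N →
        0 < archFactor Ψ K * singularProduct Ψ →
        ∀ i : Fin t, ∀ w : Fin t → ℝ, (∀ k, 0 < w k ∧ w k ≤ 1) →
        ∀ ζ : ℂ, fibre t N (slowDegree N) Ψ K i w ζ = 0 → ζ.im = 0) := by
  intro h
  obtain ⟨N₀, hN₀⟩ := h 1 1 le_rfl
  have hb := hN₀ (max N₀ 1) (le_max_left _ _) (fun _ => ⟨fun _ => 1, 0⟩) isNondegenerateSystem_id
    (affLinSize_id _) (Set.Icc (fun _ : Fin 1 => (1 / 3 : ℝ)) (fun _ => 2 / 3)) (convex_Icc _ _)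
    (middleThird_subset_realBox (le_max_right _ _)) ?_ 0 (fun _ => 1) (fun _ => ⟨one_pos, le_rfl⟩)
    Complex.I (fibre_eq_zero_of_forall_not_mem _ (fun n _ => realPoint_not_mem_middleThird n) _ _ _)
  · simp at hb
  · rw [archFactor_id_middleThird, singularProduct_id]
    norm_num

/-- **A fortiori the mass floor cannot be dropped.** -/
theorem fibreHyperbolicityAlong_false_without_mass :
    ¬ (∀ (t L : ℕ), 1 ≤ t → ∃ N₀ : ℕ, ∀ N : ℕ, N₀ ≤ N →
        ∀ Ψ : Fin t → AffLinForm 1, IsNondegenerateSystem Ψ → affLinSize Ψ N ≤ L →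
        ∀ K : Set (Fin 1 → ℝ), Convex ℝ K → K ⊆ realBox 1 N →
        ∀ i : Fin t, ∀ w : Fin t → ℝ, (∀ k, 0 < w k ∧ w k ≤ 1) →
        ∀ ζ : ℂ, fibre t N (slowDegree N) Ψ K i w ζ = 0 → ζ.im = 0) := by
  intro h
  refine fibreHyperbolicityAlong_false_without_massFloor fun t L ht => ?_
  obtain ⟨N₀, hN₀⟩ := h t L ht
  exact ⟨N₀, fun N hN Ψ hΨ hL K hK hKN _ => hN₀ N hN Ψ hΨ hL K hK hKN⟩

/-- **(b) Convexity of `K` cannot be dropped, even at full mass** (`t = 1`, `L = 1`, `η = 1`, `ψ(n) = n` on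
`[-N, N] ∖ ℤ`: `β_∞ = N`, `𝔖 = 1`, zero fibre, `ζ = i`). -/
theorem fibreHyperbolicityAlong_false_without_convexity :
    ¬ (∀ (t L : ℕ), 1 ≤ t → ∀ η : ℝ, 0 < η → ∃ N₀ : ℕ, ∀ N : ℕ, N₀ ≤ N →
        ∀ Ψ : Fin t → AffLinForm 1, IsNondegenerateSystem Ψ → affLinSize Ψ N ≤ L →
        ∀ K : Set (Fin 1 → ℝ), K ⊆ realBox 1 N →
        η * (N : ℝ) ≤ archFactor Ψ K * singularProduct Ψ →
        ∀ i : Fin t, ∀ w : Fin t → ℝ, (∀ k, 0 < w k ∧ w k ≤ 1) →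
        ∀ ζ : ℂ, fibre t N (slowDegree N) Ψ K i w ζ = 0 → ζ.im = 0) := by
  intro h
  obtain ⟨N₀, hN₀⟩ := h 1 1 le_rfl 1 one_pos
  have hb := hN₀ N₀ le_rfl (fun _ => ⟨fun _ => 1, 0⟩) isNondegenerateSystem_id (affLinSize_id _)
    (realBox 1 (N₀ : ℝ) \ {x : Fin 1 → ℝ | ∃ m : ℤ, x = fun _ => (m : ℝ)}) Set.sdiff_subset ?_ 0
    (fun _ => 1) (fun _ => ⟨one_pos, le_rfl⟩) Complex.I
    (fibre_eq_zero_of_forall_not_mem _ (fun n _ => realPoint_not_mem_boxMinusLattice N₀ n) _ _ _)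
  · simp at hb
  · rw [archFactor_id_boxMinusLattice, singularProduct_id]
    simp

/-- **(c) The frozen fugacities must be strictly positive** (`t = 2`, `L = 3`, `η = 𝔖(2)/2`, the twin system
on `[-N, N]`: `β_∞ = N`, `∏_p β_p = 𝔖(2) > 0`; coordinate `0`, `w = (1, 0)`, zero fibre, `ζ = i`). -/
theorem fibreHyperbolicityAlong_false_without_fugacityPositivity :
    ¬ (∀ (t L : ℕ), 1 ≤ t → ∀ η : ℝ, 0 < η → ∃ N₀ : ℕ, ∀ N : ℕ, N₀ ≤ N →
        ∀ Ψ : Fin t → AffLinForm 1, IsNondegenerateSystem Ψ → affLinSize Ψ N ≤ L →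
        ∀ K : Set (Fin 1 → ℝ), Convex ℝ K → K ⊆ realBox 1 N →
        η * (N : ℝ) ≤ archFactor Ψ K * singularProduct Ψ →
        ∀ i : Fin t, ∀ w : Fin t → ℝ, (∀ k, 0 ≤ w k ∧ w k ≤ 1) →
        ∀ ζ : ℂ, fibre t N (slowDegree N) Ψ K i w ζ = 0 → ζ.im = 0) := by
  intro h
  have hS : 0 < goldbachSingularSeries 2 := goldbachSingularSeries_pos (by decide)
  obtain ⟨N₀, hN₀⟩ := h 2 3 (by norm_num) (goldbachSingularSeries 2 / 2) (by positivity)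
  have hN2 : 2 ≤ max N₀ 2 := le_max_right _ _
  have hb := hN₀ (max N₀ 2) (le_max_left _ _) (shiftPairSystem 2)
    (isNondegenerateSystem_shiftPairSystem_iff.mpr (by norm_num))
    (by exact_mod_cast affLinSize_shiftPairSystem_le (h := 2) (by omega) hN2)
    (realBox 1 (max N₀ 2 : ℕ)) (convex_Icc _ _) subset_rfl ?_ 0
    (fun k => if k = 0 then 1 else 0) (fun k => by fin_cases k <;> simp) Complex.I
    (fibre_twin_eq_zero_of_fugacity_zero _ _ _ _)
  · simp at hb
  · have hA := archFactor_shiftPairSystem 2 (max N₀ 2)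
    have hSS := singularProduct_shiftPairSystem (h := 2) (by decide) (by decide)
    push_cast at hA hSS ⊢
    rw [hA, hSS]
    have hN : (0 : ℝ) ≤ max (N₀ : ℝ) 2 := le_max_of_le_right (by norm_num)
    nlinarith [mul_nonneg hN hS.le]

/-- `FibreHyperbolicityAlong` itself IMPLIES the positive-mass and dropped-hypothesis-free forms are moot: it
yields, for every admissible `(Ψ, K)` of mass `≥ ηN` at every large scale, an inhabited joint rough cell of
roughness `N^{1/slowDegree N}` (the almost-prime `t`-tuple content of the clause). -/
theorem exists_roughTuple_of_fibreHyperbolicityAlong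
    (h : Summit.Parity.GeneralizedHardyLittlewood.Cruxes.AbsoluteUpgrade.DipMarginRateExchange.FibreHyperbolicityAlong)
    (t L : ℕ) (ht : 1 ≤ t) (η : ℝ) (hη : 0 < η) :
    ∃ N₀ : ℕ, ∀ N : ℕ, N₀ ≤ N → ∀ Ψ : Fin t → AffLinForm 1, IsNondegenerateSystem Ψ →
      affLinSize Ψ N ≤ L → ∀ K : Set (Fin 1 → ℝ), Convex ℝ K → K ⊆ realBox 1 N →
        η * (N : ℝ) ≤ archFactor Ψ K * singularProduct Ψ →
          ∃ j ∈ Fintype.piFinset (fun _ : Fin t => Finset.Icc 1 (slowDegree N)),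
            jointCell t N (slowDegree N) Ψ K j ≠ 0 := by
  obtain ⟨N₀, hN₀⟩ := h t L ht η hη
  refine ⟨N₀, fun N hN Ψ hΨ hL K hK hKN hm => ?_⟩
  have ht0 : 0 < t := ht
  exact exists_jointCell_ne_zero_of_fibreShape (i := ⟨0, ht0⟩) (w := fun _ => 1)
    (hN₀ N hN Ψ hΨ hL K hK hKN hm ⟨0, ht0⟩ (fun _ => 1) (fun _ => ⟨one_pos, le_rfl⟩))

end FibreAlong

/-! ### §8.3 Why the unguarded inputs resist (paper analysis; nothing asserted)

* `FibreHyperbolicityAlong` (unguarded).  In the Hardy–Littlewood world with `(log N)^{-A}`-uniform errors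
  the joint cells are `C_j ≈ 𝔖 ∫_K ∏_i g_{j_i}(ψ_i(x)) dx`, `g_j(v)` = local density of
  `{P⁻ > N^{1/U}, Ω = j}` at height `v`, so each fibre is a POSITIVE MIXTURE over `x ∈ K` of the local rows
  `ζ F_{u(x)}(ζ)`, `u(x) = U log ψ_i(x)/log N`, concentrated on a `u'`-window of width `O(U log(2L)/log N)`
  below `U = slowDegree N ≍ √(log log N)`.  The model rows are real-rooted with simple zeros for every REAL
  roughness (the tree's `WindowChain`: `modelEval N τ z ≠ 0` on the upper half-plane), their zeros move by a
  relative `O(U²/log N)` across the window, and a coefficientwise relative perturbation `ρ` preserves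
  real-rootedness as long as `ρ < min_k θ_k(U)` (lobe heights; `θ_k(U) ≍ U^{-2k}/log U`, the lead's
  numerics, and `min_k ≈ e^{-0.93U}`); here `ρ ≍ (log log N)/log N ≪ e^{-0.47√(log log N)}` and the
  parity tilts induced by `(log N)^{-A}` errors are smaller still.  So no inconsistency with HL: a kill would
  refute uniform Hardy–Littlewood with rates.  At `t = 1` the clause is parity-free (one progression segment)
  and provable in principle from the proved `ModelHyperbolicity` machinery + equidistribution.
* `CellParityLawSaving` (unguarded).  Every smooth secondary term (li-curvature `1/log N`, value scale
  `≤ 2LN` versus model scale `N`: `O(U² log(2L)/log N)` through `u I_j'/I_j ≤ U²`, `𝔖 ≤ C(log log N)^{t-1}`,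
  `I_j ≤ U`) is `O(polyloglog N / log N)` relative, hence inside the absolute allowance `N/(log N)^{t+δ}`
  for every `δ < 1`; top cells `j_i = U` (model `A_U(N) = 0`, actual `≲ N e^{O(U)}/(log N)^{U+t-1}`) are
  inside it once `U ≥ 2`.  With `δ > 1` the clause would be FALSE already at `t = 1`: for `ψ(n) = n`,
  `K = [0, N/2]` the cells at `x = N/2` deviate from half the model cells by the li-curvature and the
  `u`-sensitivity of the top densities — numerics (this seat, `delta_check.py`, `N = 4·10⁶`, `U = 4`):
  relative deviations `(+0.79, -0.45, -4.9)/log N` for `j = 1, 2, 3`, so the two ODD cells already disagree by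
  `5.7/log N` and no single `θ₀` fits both beyond one logarithm — but the clause only asks `∃ δ > 0`; not
  formalised (needs second-order asymptotics of two rough cells).  At
  `t = 1` the clause is provable with `θ₀ = 0` and any `δ < 1` (PNT in progressions with log-power savings
  for almost-primes); for `t ≥ 2` it is Hardy–Littlewood for rough cells with a log-power rate — crux-3
  strength, as filed.
* Hence NO KILL of the line's inputs is available; the negative content of this cycle is §8.1 (irrefutability
  and inertness of the guard) and §8.2 (restatement constraints).  No `-- Targets`: the payload's
  `stuck_stubs` / `targets` are empty (the lead's open stubs are the two conjectural inputs). -/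


/-! ### §8.4 Load-bearing hypothesis of the unguarded input `CellParityLawSaving`: box containment

(LANDED as `Theorems/AbsoluteUpgrade/Negative/CellParityLawSavingLoadBearing.lean`, p114876; reproduced.)  The
rate clause has a purely ABSOLUTE allowance `N/(log^t N (log N)^δ)` and free Walsh amplitudes `θ_S`; neither
rescues a body outside the box: for `ψ(n) = n` on `[2N, 10N]` the joint cells are empty while the models of the
cells `j = 1, 2` are `8(1 ± θ₀)A_{1,2}(N) ≥ 8(1 ± θ₀) cN/log N` (rough anatomy at `u = 4`, monotone in `u ≥ 4`),
and `(1+θ₀) + (1-θ₀) = 2`.  So `K ⊆ [-N, N]` is load-bearing exactly as for `PrimeCellsRelative`; the other three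
standing hypotheses (non-degeneracy, size bound, convexity) are load-bearing by the same witnesses as in
`Theorems/PrimeCellsRelative/Negative/*` (not repeated). -/

section CellSavingSec

open Summit.Parity.GeneralizedHardyLittlewood.Cruxes.FibreHyperbolicity.ModelTransfer (jointCell)
open Summit.Parity.GeneralizedHardyLittlewood.Cruxes.AbsoluteUpgrade.DipMarginRateExchange
  (slowDegree four_le_slowDegree)
open Summit.Parity.GeneralizedHardyLittlewood.Theorems.ModelHyperbolicity.Negative (cell)
open Summit.Parity.GeneralizedHardyLittlewood.Cruxes.AbsoluteUpgrade.NlcCellsAbsoluteClip (roughCell)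
open Summit.Parity.GeneralizedHardyLittlewood.Theorems.AbsoluteUpgrade (roughCell_four_le stub_roughAnatomy)
open Summit.Parity.GeneralizedHardyLittlewood.Theorems.PrimeCellsRelative.Negative.BoxContainment
  (archFactor_id_farBox singularProduct_id)
open FibreAlong (jointCell_eq_zero_of_forall_not_mem isNondegenerateSystem_id affLinSize_id)

namespace CellSaving

/-- The two cell vocabularies agree: `Negative.cell u N m = NlcCellsAbsoluteClip.roughCell N u m`. [folklore] -/
theorem cell_eq_roughCell (u N m : ℕ) : cell u N m = roughCell N u m := rfl

/-- No lattice point of `[-N, N]` has its real point in the far box `[2N, 10N]` (`N ≥ 1`). [folklore] -/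
theorem realPoint_not_mem_farBox {N : ℕ} (hN : 1 ≤ N) {n : Fin 1 → ℤ} (hn : n ∈ latticeBox 1 N) :
    realPoint n ∉ Set.Icc (fun _ : Fin 1 => (2 * N : ℝ)) (fun _ => 10 * N) := by
  rintro ⟨h1, -⟩
  have h1' : (2 * N : ℝ) ≤ (n 0 : ℝ) := h1 0
  simp only [latticeBox, Fintype.mem_piFinset, Finset.mem_Icc] at hn
  have h2 : (n 0 : ℝ) ≤ N := by exact_mod_cast (hn 0).2
  have hN' : (1 : ℝ) ≤ N := by exact_mod_cast hN
  linarith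

/-- The Walsh form at `t = 1`: `Σ_{S ⊆ {0}} θ_S ∏_{i∈S} (-1)^{j_i+1} = θ_∅ + θ_{{0}} (-1)^{j_0+1}`. [folklore] -/
theorem walsh_fin_one (θ : Finset (Fin 1) → ℝ) (j : Fin 1 → ℕ) :
    (∑ S : Finset (Fin 1), θ S * ∏ i ∈ S, (-1 : ℝ) ^ (j i + 1)) =
      θ ∅ + θ Finset.univ * (-1 : ℝ) ^ (j 0 + 1) := by
  have huniv : (Finset.univ : Finset (Finset (Fin 1))) = {∅, Finset.univ} := by
    ext S
    simp only [Finset.mem_univ, Finset.mem_insert, Finset.mem_singleton, true_iff]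
    rcases S.eq_empty_or_nonempty with h | ⟨x, hx⟩
    · exact Or.inl h
    · right
      rw [Finset.eq_univ_iff_forall]
      intro y
      rwa [Subsingleton.elim y x]
  have hne : (∅ : Finset (Fin 1)) ≠ Finset.univ := Finset.univ_nonempty.ne_empty.symm
  rw [huniv, Finset.sum_pair hne, Finset.prod_empty, mul_one, Fin.prod_univ_one]

end CellSaving

open CellSaving

/-- **The box containment `K ⊆ [-N, N]` of `CellParityLawSaving` cannot be dropped.** Without it, at `t = 1`,
`L = 1`: `ψ(n) = n` on the far box `[2N, 10N]` has empty joint cells against the models `8(1 ± θ₀) A_{1,2}(N)`,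
`A_m(N) ≥ c N/log N` (rough anatomy at `u = 4` and monotonicity in `u ≥ 4`), and `(1+θ₀) + (1-θ₀) = 2` forces a
deviation `≥ 8cN/log N > N/(log N)^{1+δ}` for `(log N)^δ > 1/c`. [folklore] -/
theorem cellParityLawSaving_false_without_boxContainment :
    ¬ (∀ (t L : ℕ), 1 ≤ t → ∃ δ : ℝ, 0 < δ ∧ ∃ N₀ : ℕ, ∀ N : ℕ, N₀ ≤ N →
        ∀ Ψ : Fin t → AffLinForm 1, IsNondegenerateSystem Ψ → affLinSize Ψ N ≤ L →
        ∀ K : Set (Fin 1 → ℝ), Convex ℝ K →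
        ∃ θ : Finset (Fin t) → ℝ, θ ∅ = 1 ∧ (∀ S, |θ S| ≤ 2) ∧
          ∀ j : Fin t → ℕ, (∀ i, 1 ≤ j i ∧ j i ≤ slowDegree N) →
            |(jointCell t N (slowDegree N) Ψ K j : ℝ) -
                (∑ S : Finset (Fin t), θ S * ∏ i ∈ S, (-1 : ℝ) ^ (j i + 1)) *
                  (archFactor Ψ K * singularProduct Ψ *
                    ∏ i, (cell (slowDegree N) N (j i) : ℝ) / N)| ≤
              (N : ℝ) / (Real.log N ^ t * Real.log N ^ δ)) := by
  intro h
  obtain ⟨δ, hδ, N₀, hN₀⟩ := h 1 1 le_rfl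
  obtain ⟨c, hc, N₁, hN₁⟩ := stub_roughAnatomy 4
  -- a scale with everything in place
  have hT3 : Tendsto (fun N : ℕ => Real.log (Real.log (Real.log (N : ℝ)))) atTop atTop :=
    Real.tendsto_log_atTop.comp (Real.tendsto_log_atTop.comp
      (Real.tendsto_log_atTop.comp tendsto_natCast_atTop_atTop))
  have hTp : Tendsto (fun N : ℕ => Real.log (N : ℝ) ^ δ) atTop atTop :=
    (tendsto_rpow_atTop hδ).comp (Real.tendsto_log_atTop.comp tendsto_natCast_atTop_atTop)
  have hev : ∀ᶠ N : ℕ in atTop, N₀ ≤ N ∧ N₁ ≤ N ∧ 3 ≤ N ∧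
      1 ≤ Real.log (Real.log (Real.log (N : ℝ))) ∧ 1 / c < Real.log (N : ℝ) ^ δ :=
    (eventually_ge_atTop N₀).and ((eventually_ge_atTop N₁).and ((eventually_ge_atTop 3).and
      ((hT3.eventually_ge_atTop 1).and (hTp.eventually_gt_atTop (1 / c)))))
  obtain ⟨N, hNN₀, hNN₁, hN3, hlll, hpow⟩ := hev.exists
  have hN1 : 1 ≤ N := by omega
  have hNpos : (0 : ℝ) < N := by exact_mod_cast (show 0 < N by omega)
  have hlogpos : 0 < Real.log N := Real.log_pos (by exact_mod_cast (show 1 < N by omega))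
  have hP : 0 < Real.log N ^ δ := Real.rpow_pos_of_pos hlogpos δ
  -- rough anatomy at `u = 4`, transported to `u = slowDegree N ≥ 4`
  obtain ⟨hlow, -, -⟩ := hN₁ N hNN₁ 4 le_rfl (by push_cast; linarith)
  have hA1 : c * N / Real.log N ≤ (cell (slowDegree N) N 1 : ℝ) := by
    refine (hlow 1 (by simp)).trans ?_
    rw [cell_eq_roughCell]
    exact_mod_cast roughCell_four_le hN1 (four_le_slowDegree N) 1
  have hA2 : c * N / Real.log N ≤ (cell (slowDegree N) N 2 : ℝ) := by
    refine (hlow 2 (by simp)).trans ?_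
    rw [cell_eq_roughCell]
    exact_mod_cast roughCell_four_le hN1 (four_le_slowDegree N) 2
  have hB : 0 < c * N / Real.log N := by positivity
  -- the law on the far box
  obtain ⟨θ, hθ0, -, hj⟩ := hN₀ N hNN₀ (fun _ => ⟨fun _ => 1, 0⟩) isNondegenerateSystem_id
    (affLinSize_id _) (Set.Icc (fun _ : Fin 1 => (2 * N : ℝ)) (fun _ => 10 * N)) (convex_Icc _ _)
  have hU4 := four_le_slowDegree N
  have h1 := hj (fun _ => 1) (fun _ => ⟨le_rfl, by omega⟩)
  have h2 := hj (fun _ => 2) (fun _ => ⟨by norm_num, by omega⟩)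
  have hz : ∀ j : Fin 1 → ℕ, (jointCell 1 N (slowDegree N) (fun _ => ⟨fun _ => 1, 0⟩)
      (Set.Icc (fun _ : Fin 1 => (2 * N : ℝ)) (fun _ => 10 * N)) j : ℝ) = 0 := fun j => by
    rw [jointCell_eq_zero_of_forall_not_mem _ (fun n hn => realPoint_not_mem_farBox hN1 hn) j]
    simp
  rw [hz, walsh_fin_one, hθ0, archFactor_id_farBox, singularProduct_id, Fin.prod_univ_one, pow_one,
    zero_sub, abs_neg] at h1 h2
  -- the two models: `8 (1 + θ₀) A₁` and `8 (1 - θ₀) A₂`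
  set x : ℝ := θ Finset.univ with hx
  set a₁ : ℝ := (cell (slowDegree N) N 1 : ℝ) with ha₁
  set a₂ : ℝ := (cell (slowDegree N) N 2 : ℝ) with ha₂
  set E : ℝ := (N : ℝ) / (Real.log N * Real.log N ^ δ) with hE
  have hE0 : 0 ≤ E := by positivity
  have hm1 : (1 + x * (-1 : ℝ) ^ (1 + 1)) * (8 * (N : ℝ) * 1 * (a₁ / N)) = (1 + x) * (8 * a₁) := by
    field_simp
    norm_num
    ring
  have hm2 : (1 + x * (-1 : ℝ) ^ (2 + 1)) * (8 * (N : ℝ) * 1 * (a₂ / N)) = (1 - x) * (8 * a₂) := by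
    field_simp
    norm_num
    ring
  rw [hm1] at h1
  rw [hm2] at h2
  have e1 : (1 + x) * (8 * a₁) ≤ E := (le_abs_self _).trans h1
  have e2 : (1 - x) * (8 * a₂) ≤ E := (le_abs_self _).trans h2
  have f1 : (1 + x) * (8 * (c * N / Real.log N)) ≤ E := by
    rcases le_or_gt 0 (1 + x) with hx0 | hx0
    · exact le_trans (by gcongr) e1
    · have : (1 + x) * (8 * (c * N / Real.log N)) < 0 := mul_neg_of_neg_of_pos hx0 (by positivity)
      linarith
  have f2 : (1 - x) * (8 * (c * N / Real.log N)) ≤ E := by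
    rcases le_or_gt 0 (1 - x) with hx0 | hx0
    · exact le_trans (by gcongr) e2
    · have : (1 - x) * (8 * (c * N / Real.log N)) < 0 := mul_neg_of_neg_of_pos hx0 (by positivity)
      linarith
  have hfinal : 8 * (c * N / Real.log N) ≤ E := by linarith
  -- `8 c (log N)^δ ≤ 1` against `c (log N)^δ > 1`
  rw [hE, show 8 * (c * (N : ℝ) / Real.log N) = 8 * c * N / Real.log N by ring,
    div_le_div_iff₀ hlogpos (mul_pos hlogpos hP)] at hfinal
  have hcP : 1 < c * Real.log N ^ δ := by
    have := (div_lt_iff₀ hc).mp hpow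
    linarith [mul_comm (Real.log (N : ℝ) ^ δ) c]
  nlinarith [mul_lt_mul_of_pos_right hcP (mul_pos hNpos hlogpos), mul_pos hNpos hlogpos]


end CellSavingSec


/-! ### §8.5 Numerics — the route's cheapest falsifier (iii), actual fibres at finite `N` (nothing asserted)

LOCAL (this seat, `fibre_local.py`, pure Python, EXACT Sturm counts over `ℚ`; evidence
`evidence_fibre_numerics_1e7.md` on the item): `N = 10⁷`, `K = [1, N]`, shift pairs `(n, n+h)`, `h ∈ {2, 6}`,
roughness `N^{1/u}`, `u ∈ {4, 5, 6}`, both coordinates, frozen fugacity `w ∈ {1, 1/4, a₁/3, → 0}`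
(`a₁ = A₁(N)/N`; `{a₁/3, 1}` is exactly the grid `stub_quantClip` uses): ALL 48 fibre polynomials and the 3
one-form rows are REAL-ROOTED (48/48 + 3/3, 0 non-real).  Sample zeros (`u = 6`, `h = 2`, coordinate 0):
`w = 1`: `-73.9, -10.0, -3.06, -1.051`; `w → 0`: `-110.5, -8.73, -3.02, -1.063` (the top zero is set by the tiny
top cell `C_{(5,·)} ≈ 20–40` and is noise; Newton's inequality at the top is slack, so this noise cannot create
a complex pair).  Joint cells `u = 6`, `h = 2` (rows `j₁`, cols `j₂ = 1..5`):
`58977 82445 27551 2377 27 / 82249 115102 37923 3104 39 / 27664 37973 11798 865 5 / 2344 3069 881 39 1 /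
19 43 10 0 0`; one-form cells `A_j(10⁷; u = 6) = 664573, 925049, 303614, 24537, 307`.
KIT j018789 (`N = 10⁸`, numpy on cmp-19, same exact Sturm verdicts; evidence `compute-j018789.json` +
`outputs/summary.txt` on the item): `u ∈ {4, 5, 6, 7}`, `h ∈ {2, 6, 30}`, both coordinates,
`w ∈ {1, ½, ¼, 1/20, a₁/3, →0}` — 144/144 fibres and 4/4 one-form rows REAL-ROOTED, 0 non-real.  Zeros at
`u = 7`, `h = 2`, coordinate 0: `w = 1`: `-181.6, -19.82, -6.85, -2.563, -1.022`; `w → 0`: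
`-233.3, -18.89, -6.43, -2.539, -1.020` (the frozen fugacity moves only the noisy top zero).  WALSH FITS (least
squares of `C_j` against `X₀ a_{j₁} a_{j₂} N (1 + θ₁ s₁ + θ₂ s₂ + θ₁₂ s₁ s₂)`, `s = (-1)^{j+1}`): the fitted mass
`X₀ = 1.3227 / 2.6456 / 3.5273` (`u = 4`; `h = 2 / 6 / 30`) reproduces the singular series `𝔖(h) = 2C₂,
4C₂, (16/3)C₂ = 1.3203, 2.6406, 3.5208` to 0.3%, and EVERY fitted parity amplitude is tiny:
`|θ₁|, |θ₂|, |θ₁₂| ≤ 1.1·10⁻³` for all twelve `(u, h)` — two orders of magnitude below the model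
hyperbolicity thresholds `θ*(u) = 0.175, 0.055, 0.020, 0.010` (`u = 4..7`).  So at every accessible scale
the actual joint cells sit DEEP INSIDE the hyperbolic region and carry no visible parity ghost: there is NO
finite-`N` counterexample to `FibreHyperbolicity` / `FibreHyperbolicityAlong` / the parity-vector form of the
law, in line with §8.3.  The `t = 1` half-interval table `(A_j(N/2; N^{1/u})/(A_j(N)/2) - 1)·log N` at
`N = 10⁸`: `u = 4`: `+0.770, -0.335, -4.561`; `u = 7`: `+0.770, +0.150, -1.061, -3.123, -6.489, -12.340`
(`j = 1, 2, …`) — the li-curvature plus the `u`-sensitivity of the top densities: the smooth, parity-blind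
`1/log N` secondary terms that force `δ < 1` in `CellParityLawSaving` (§8.3) and are invisible to `θ_S`.
(The `N = 10⁹` replica j018790 was withdrawn to spare the shared queue: one more decade cannot change a
two-orders-of-magnitude margin.) -/

end Summit.Parity.GeneralizedHardyLittlewood.Cruxes.AbsoluteUpgrade.Disproof

end
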